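import Summits.Ventures.QEC.Thresholds.ToricCodeThresholdUnconditional
import Summits.Ventures.QEC.Thresholds.ToricCodeLossThresholds
import Summits.Ventures.QEC.Thresholds.ToricCodeLossErrorTradeoff
import Literature.InformationTheory.QuantumCodes.ToricCodeLatticeConverses
import HarnessLib

/-!
# The lattice toric code: certified two-sided INTERVALS `.0293 < p_c ≤ 1/4`, `.3373 < y_c ≤ 1/2` and the
# loss–error ceiling curve `p₀(y) ≤ (1 − 2y)/(4(1 − y))` — every decoder on the ceiling side

Venture QEC, `Summits/Ventures/QEC/Thresholds/` (LADDER-QEC rung Q5; qec-lit-2 gen 4). HONEST FRAMING. The DKLP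
rows of the census (`toricFailureFamily`, `ToricCode.erasureFamily`, `ToricCode.mixedFamily` — the LATTICE toric
code `ToricCode.toricCode L`, objects of `ToricCodeThresholdUnconditional.lean`, `ToricCodeLossThresholds.lean`,
`ToricCodeLossErrorTradeoff.lean`) carried only certified FLOORS. `Literature/…/ToricCodeLatticeConverses.lean`
PROVES that the `X ↔ Z` exchange of the lattice toric code is its re-indexing along the lattice duality, whence the
two sectors share the loss law and every converse of `CSSThresholdConverses.lean` / `CSSMixedChannelConverse.lean`
becomes a one-sector CEILING. Packaging as intervals:

* **code capacity, minimum-weight decoders**: `.0293 < p_c ≤ 1/4` (`toric_capacity_accuracyThreshold_mem`); the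
  ceiling `p_c ≤ 1/4` holds for EVERY decoder family (`toric_capacity_threshold_le_quarter`; numerics: MWPM `.103`,
  optimal `.109` — VALIDATED column, not theorems);
* **losses**: `.3373 < y_c ≤ 1/2` (`toric_loss_accuracyThreshold_mem`, ceiling = `ToricCode.erasure_threshold_le_half`;
  printed `.5` by bond percolation — VALIDATED);
* **losses + flips**: the ceiling curve `≤ (1 − 2y)/(4(1 − y))` for `mixedFamily D y` is the Literature theorem
  `ToricCode.mixed_threshold_le` (ANY erasure-aware decoders; not restated); here the sample point `y = 1/4 ⇒ ≤ 1/6`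
  (`toric_mixed_threshold_le_quarter_loss`), matching the floor region `μ·Υ_CSS(y,p) < 1` of
  `ToricCodeLossErrorTradeoff.lean`.

Kernel axioms only; no named fact; no `native_decide`; no new definition.

## References

* [DennisEtAl2002] E. Dennis, A. Kitaev, A. Landahl, J. Preskill, J. Math. Phys. 43 (2002) 4452, §3.1, §4.6, §5.3.
* [StaceBarrettDoherty2009] T. M. Stace, S. D. Barrett, A. C. Doherty, PRL 102 (2009) 200501, pp. 1–2, Fig. 2.
* [RichardsonUrbanke2008] T. Richardson, R. Urbanke, *Modern Coding Theory*, Lemma 4.78 (Erasure Decomposition).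
-/

noncomputable section

namespace Summit.Ventures.QEC.Thresholds

open Filter Topology
open Literature.InformationTheory.QuantumCodes
open Literature.InformationTheory.QuantumCodes.ToricCode

open Classical in
/-- **Toric code-capacity threshold `≤ 1/4` for EVERY decoder family** (lattice toric code, DKLP family
`toricFailureFamily D`). [cite: RichardsonUrbanke2008, Lemma 4.78 (Erasure Decomposition Lemma); DennisEtAl2002, §4.6 (p_c)] -/
theorem toric_capacity_threshold_le_quarter (D : (L : ℕ) → ZDecoder (L + 1)) {a : ℝ}
    (ha : IsThresholdLowerBound (toricFailureFamily D) a) : a ≤ 1 / 4 :=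
  ToricCode.capacity_threshold_le_quarter D ha

open Classical in
/-- **`.0293 < p_c ≤ 1/4` for the toric code under independent flips**, every family of minimum-weight decoders
(floor: DKLP with the memory-4 walk count; ceiling: every decoder). A certified two-sided interval; the printed
values `.103` (MWPM) / `.109` (optimal) are numerics. [cite: DennisEtAl2002, §5.3 eq. (p_c_2d) and §4.6; RichardsonUrbanke2008, Lemma 4.78] -/
theorem toric_capacity_accuracyThreshold_mem {D : (L : ℕ) → ZDecoder (L + 1)}
    (hD : ∀ L, (D L).IsMinWeight (syn (L + 1)) (cycles (L + 1)) hammingNorm) :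
    (0.0293 : ℝ) < accuracyThreshold (toricFailureFamily D) ∧ accuracyThreshold (toricFailureFamily D) ≤ 1 / 4 :=
  ⟨accuracyThreshold_gt_0293 hD,
    ToricCode.capacity_threshold_le_quarter D (isThresholdLowerBound_accuracyThreshold _)⟩

open Classical in
/-- Accuracy-threshold form, every decoder family: `p_c ≤ 1/4` for the lattice toric code.
[cite: DennisEtAl2002, §4.6 (p_c); RichardsonUrbanke2008, Lemma 4.78] -/
theorem toric_capacity_accuracyThreshold_le_quarter (D : (L : ℕ) → ZDecoder (L + 1)) :
    accuracyThreshold (toricFailureFamily D) ≤ 1 / 4 :=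
  ToricCode.capacity_accuracyThreshold_le_quarter D

/-- **`.3373 < y_c ≤ 1/2` for the toric loss threshold** — a certified two-sided interval (floor: memory-4 walk
count; ceiling: no-cloning dichotomy, every decoder). Printed value `.5` (bond percolation) is NOT proved.
[cite: StaceBarrettDoherty2009, pp. 1–2; DumerKovalevPryadko2015, p. 5] -/
theorem toric_loss_accuracyThreshold_mem :
    (0.3373 : ℝ) < accuracyThreshold erasureFamily ∧ accuracyThreshold erasureFamily ≤ 1 / 2 :=
  ⟨loss_accuracyThreshold_gt_0337, ToricCode.erasure_threshold_le_half (isThresholdLowerBound_accuracyThreshold _)⟩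

open Classical in
/-- **Two-sided loss–error statement at one point** (illustration): at loss rate `y = 1/4`, every erasure-aware
decoder family of the toric code has flip threshold `≤ 1/6`, while the memory-4 floor certifies the points with
`26^{1/3}·Υ_CSS(1/4, p) < 1`. [cite: StaceBarrettDoherty2009, p. 2 and Fig. 2] -/
theorem toric_mixed_threshold_le_quarter_loss (D : (L : ℕ) → ErasureDecoder (Edge (L + 1)) (Syndrome (L + 1)))
    {a : ℝ} (ha : IsThresholdLowerBound (mixedFamily D (1 / 4)) a) : a ≤ 1 / 6 := by
  have h := ToricCode.mixed_threshold_le D (y := 1 / 4) (by norm_num) (by norm_num) ha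
  norm_num at h
  linarith

end Summit.Ventures.QEC.Thresholds
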